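import Summits.ABC.IUTFork.LDHGenuineStepVBound
import Summits.ABC.IUTFork.LDHSlotResidue
import HarnessLib

/-!
# The fork at [IUTchIII] Corollary 3.12, L-DH level: the computable half of [IUTchIV] Thm. 1.10 for the GENUINE
# datum in ALL regimes — the slot-constancy hypothesis replaced by the additive (Ind1) slot residue

Record-only PROOF file (D-0012) of the abc-iut cell (campaign-S seat abc-iut-S8); TAKES NO SIDE. S. Mochizuki,
*IUT IV* [Mochizuki2012], proof of Thm. 1.10 Steps (v)–(viii) pp. 27–30; Dupuy–Hilado, arXiv:2004.13228
[DupuyHilado2025] §3.3, §3.6, §4.7, §4.11–4.12; the cell's audit note HOME/plan/c312/STEPV-IND1-NOTE.md (R2).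

abc-iut-c312-d1's `LDHGenuineStepVSum.lean` proves, for every genuine Θ-volume input `I`, the `λ_min` form
`negLogThetaNonarch_le_min` (NO hypothesis on the datum; the `q`-term appears as abc-iut-S3's least-slot averages
`Σ_p procAvg_j (j²/2l)·m_j(p)`) and, UNDER SLOT-CONSTANCY of the canonical `log(q_v)`, the text's form
`hullEstimateOf_ofInput_explicit : I.HullEstimateOf δ_K(I)`. This file removes the slot-constancy hypothesis:
* `sum_procAvg_minAvg_eq_ndegLgpSlotMin` — with the canonical local data (`λ_v = n_v`, `log(q_v) = logQloc`),
  `Σ_{p∈T} procAvg_j (j²/2l)·m_j(p) = PilotData.ndegLgpSlotMin X T` (abc-iut-S3's `minAvg` currency IS the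
  least-slot aggregate of `PilotSlotResidue.lean`);
* **`hullEstimateOf_ofInput_allRegime`** — for EVERY genuine input:
  `I.HullEstimateOf (slotResidue(P_Θ; T(I)) + (l+1)/4·{(1+4/l)·Σ_p avg log(𝔡^K_p) + (4/l)·Σ_p log(𝔰_p) + (20/3)·l⋆·Σ_p ι_p})`;
* **`hullEstimateOf_ofInput_explicit_allRegime`** — c312-d1's `hullEstimateOf_ofInput_explicit` VERBATIM with the
  hypothesis `hconst` replaced by the additive term `I.X.slotResidue I.supportPrimes` (canonical data, threshold `N`,
  size `l⋆`, (R4)-shape input unchanged); the slot-constant / `[F_mod:ℚ] = 1` statements (c312-d1's `…_of_slotConstant`, `…_explicit_of_finrank_eq_one`)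
  are the special case `slotResidue = 0` (`PilotData.slotResidue_eq_zero_of_const` / `_of_finrank_eq_one`).
Together with the LOWER bound `slotResidue ≤ δ` for every admissible `δ` (`LDHSlotResidue.lean`), this pins the
computable half of the genuine `−|log(Θ)|` in all regimes: the (Ind1) slot residue is exactly the price of the typed
Dupuy–Hilado (Ind1) beyond print's Step (v) display, necessary (p418005) and sufficient (this file).
[cite: Mochizuki2012, IUTchIV Thm. 1.10 Steps (v)–(viii) p. 27–30] [cite: DupuyHilado2025, §3.6, §4.7, §4.11, §4.12]
[claim: Mochizuki2012, status: disputed] for every IUT quotation. Nothing asserts [IUTchIII] Cor. 3.12 or the existence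
of any datum; no side taken.
-/

noncomputable section

namespace Summit.ABC.IUTFork

namespace DHData

open Finset Literature.IUT.LogVolume Literature.IUT.LogVolume.Thm110Local NumberField IsDedekindDomain

section MinAvg

variable {F : Type} [Field F] [NumberField F] (D : DHData F)

/-- Scaling commutes with the least slot for a nonnegative constant: `c·min_k f(k) = min_k c·f(k)`. [folklore] -/
private theorem mul_inf'_eq {ι : Type*} (s : Finset ι) (H : s.Nonempty) (f : ι → ℝ) {c : ℝ} (hc : 0 ≤ c) :
    c * s.inf' H f = s.inf' H (fun k => c * f k) := by
  refine le_antisymm (Finset.le_inf' _ _ fun k hk => mul_le_mul_of_nonneg_left (Finset.inf'_le _ hk) hc) ?_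
  obtain ⟨k₀, hk₀, hmin⟩ := Finset.exists_mem_eq_inf' H f
  rw [hmin]
  exact Finset.inf'_le _ hk₀

/-- Re-indexing the procession: `Σ_{i=0}^{ℓ⋇−1} f(i+1) = Σ_{j=1}^{ℓ⋇} f(j)`. [folklore] -/
private theorem sum_fin_succ_eq_sum_Icc' (n : ℕ) (f : ℕ → ℝ) :
    ∑ i : Fin n, f ((i : ℕ) + 1) = ∑ j ∈ Icc 1 n, f j := by
  induction n with
  | zero => simp
  | succ k ih =>
    rw [Fin.sum_univ_castSucc, Finset.sum_Icc_succ_top (by omega), ← ih]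
    simp

/-- **abc-iut-S3's least-slot averages ARE the least-slot aggregate of the pilot data**: for local data with the
weights `λ_v = n_v` and the canonical `log(q_v) = 𝔮(v)·ln|κ(v)|/n_v` at every `p ∈ T` (primes),
`Σ_{p∈T} procAvg_j ((j²/2l)·m_j(p)) = PilotData.ndegLgpSlotMin X T`, where `m_j(p)` is the `λ`-weighted average over
`(j+1)`-collections of `min_k log(q_{v⃗(k)})` (`DstLocal.minAvg`) — since `θ_j(v) = (j²/2l)·log(q_v)`
(`thetaPilot = j²·qPilot`, `qPilot = 𝔮/2l`). [cite: DupuyHilado2025, §3.3, §3.6] -/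
theorem sum_procAvg_minAvg_eq_ndegLgpSlotMin {T : Finset ℕ} (hT : ∀ p ∈ T, p.Prime)
    (Dloc : (p : ℕ) → DstLocal (placesOver F p))
    (hlam : ∀ p ∈ T, ∀ v, (Dloc p).lam v = localDegree F v.1)
    (hlogQ : ∀ p ∈ T, ∀ v, (Dloc p).logQ v = D.logQloc p v) :
    ∑ p ∈ T, procAvg D.X.lstar (fun j => (j : ℝ) ^ 2 / (2 * (D.X.l : ℝ)) * (Dloc p).minAvg j) =
      D.X.ndegLgpSlotMin T := by
  unfold PilotData.ndegLgpSlotMin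
  refine Finset.sum_congr rfl fun p hp => ?_
  haveI : Fact p.Prime := ⟨hT p hp⟩
  unfold procAvg
  rw [← sum_fin_succ_eq_sum_Icc' D.X.lstar
    (fun j => (j : ℝ) ^ 2 / (2 * (D.X.l : ℝ)) * (Dloc p).minAvg j)]
  congr 1
  refine Finset.sum_congr rfl fun i _ => ?_
  -- the `(i+1)`-st least-slot average, unfolded with the canonical weights
  have hc : (0 : ℝ) ≤ (((i : ℕ) + 1 : ℕ) : ℝ) ^ 2 / (2 * (D.X.l : ℝ)) := by
    have := D.X.two_mul_l_pos
    positivity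
  rw [DstLocal.minAvg, (Dloc p).wavg_eq_sum_mul_weight (hlam p hp), Finset.mul_sum]
  refine Finset.sum_congr rfl fun e _ => ?_
  rw [← mul_assoc]
  congr 1
  rw [DstLocal.tupleMin, mul_inf'_eq _ _ _ hc]
  refine congrArg (Finset.univ.inf' Finset.univ_nonempty) (funext fun k => ?_)
  -- `θ_{i+1}(v⃗(k)) = ((i+1)²/2l)·log(q_{v⃗(k)})`
  show _ * (Dloc p).logQ (e k) = D.X.slotValue i (e k).1
  rw [hlogQ p hp, PilotData.slotValue, logQloc, PilotData.thetaPilot_eq_smul, PilotData.qPilot_eq_smul,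
    Finsupp.smul_apply, Finsupp.smul_apply, smul_eq_mul, smul_eq_mul]
  push_cast
  ring

end MinAvg

section Input

variable {F₀ : Type} [Field F₀] [NumberField F₀] {K : Type} [Field K] [NumberField K] [Algebra F₀ K]
variable (I : ThetaVolumeInput F₀ K)

/-- **The computable half in ALL regimes** ([IUTchIV] Thm. 1.10 Steps (v)–(viii) for the genuine datum, the
slot-constancy hypothesis of abc-iut-c312-d1's `hullEstimateOf_ofInput_of_slotConstant` replaced by the additive
(Ind1) slot residue): for local data dominating the genuine quantities (weights `λ_v = n_v`, canonical `log(q_v)`,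
the (R4)-shape tameness input),
`I.HullEstimateOf (slotResidue(P_Θ; T(I)) + (l+1)/4·{(1+4/l)·Σ_p avg log(𝔡^K_p) + (4/l)·Σ_p log(𝔰_p) + (20/3)·l⋆·Σ_p ι_p})`
— from the `λ_min` form `negLogThetaNonarch_le_min` and `sum_procAvg_minAvg_eq_ndegLgpSlotMin`.
[cite: Mochizuki2012, IUTchIV Thm. 1.10 Steps (v)–(viii) p. 27–30] [claim: Mochizuki2012, status: disputed] -/
theorem hullEstimateOf_ofInput_allRegime (Dloc : (p : ℕ) → DstLocal (placesOver F₀ p))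
    (hlam : ∀ p ∈ I.supportPrimes, ∀ v : placesOver F₀ p, (Dloc p).lam v = localDegree F₀ v.1)
    {lmod : ℝ} (hlmod : 0 ≤ lmod)
    (hDK : ∀ (p : ℕ) [hp : Fact p.Prime], p ∈ I.supportPrimes → ∀ v : placesOver F₀ p,
      differentOrd p ((I.σ.localFieldFamily p hp.out).k v) * Real.log p ≤ (Dloc p).logDK v)
    (hQ : ∀ p ∈ I.supportPrimes, ∀ v : placesOver F₀ p, (Dloc p).logQ v = (ofInput I).logQloc p v)
    (hlogp : ∀ p ∈ I.supportPrimes, Real.log p ≤ (Dloc p).logp)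
    (hR4 : ∀ (p : ℕ) [hp : Fact p.Prime], p ∈ I.supportPrimes → ∀ v : placesOver F₀ p,
      p - 2 < absRamificationIdx p ((I.σ.localFieldFamily p hp.out).k v) →
      3 + Real.log (absRamificationIdx p ((I.σ.localFieldFamily p hp.out).k v)) ≤ 4 * (Dloc p).iota * lmod) :
    I.HullEstimateOf
      (I.X.slotResidue I.supportPrimes +
        ((I.X.l : ℝ) + 1) / 4 * ((1 + 4 / (I.X.l : ℝ)) * (∑ p ∈ I.supportPrimes, (Dloc p).avg (Dloc p).logDK)
          + 4 / (I.X.l : ℝ) * (∑ p ∈ I.supportPrimes, (Dloc p).logp)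
          + 20 / 3 * lmod * (∑ p ∈ I.supportPrimes, (Dloc p).iota))) := by
  have h := negLogThetaNonarch_le_min I Dloc hlam hlmod hDK (fun p hp v => (hQ p hp v).le) hlogp hR4
  have e1 := sum_procAvg_minAvg_eq_ndegLgpSlotMin (ofInput I) (fun p hp => I.prime_of_mem_supportPrimes hp) Dloc
    hlam hQ
  have hs := (ofInput I).slotResidue_eq
  rw [ofInput_X, ofInput_T] at hs
  rw [ofInput_X] at e1
  rw [e1] at h
  unfold ThetaVolumeInput.HullEstimateOf
  linarith

/-- **THE COMPUTABLE HALF WITH THE STEP (v)–(viii) CONSTANT EXPLICIT IN THE INPUT, ALL REGIMES**: c312-d1's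
`hullEstimateOf_ofInput_explicit` with the slot-constancy hypothesis `hconst` REPLACED by the additive residue:
`I.HullEstimateOf (slotResidue(P_Θ; T(I)) + δ_K(I))`,
`δ_K(I) = (l+1)/4·{(1+4/l)·Σ_{p∈T(I)} (Σ_{v|p} n_v·d(K_{v̲}))/[F_mod:ℚ]·log p + (4/l)·Σ_{p∈T(I)} log p + (20/3)·l⋆·#{p ∈ T(I) : p ≤ N}}`,
under the (R4)-shape tameness input with threshold `N` and size `l⋆` only. At slot-constant data (`F_mod = ℚ`, or
one place of `F_mod` over each support prime) the residue is `0` and this is c312-d1's statement; elsewhere the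
residue is the honest extra term of the typed Dupuy–Hilado (Ind1) (STEPV-IND1-NOTE R2), sharp by `LDHSlotResidue`.
[cite: Mochizuki2012, IUTchIV Thm. 1.10 Steps (iii), (v)–(viii) p. 25–30] [claim: Mochizuki2012, status: disputed] -/
theorem hullEstimateOf_ofInput_explicit_allRegime (N : ℕ) {lmod : ℝ} (hlmod : 0 ≤ lmod)
    (hR4 : ∀ (p : ℕ) [hp : Fact p.Prime], p ∈ I.supportPrimes → ∀ v : placesOver F₀ p,
      p - 2 < absRamificationIdx p ((I.σ.localFieldFamily p hp.out).k v) →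
      p ≤ N ∧ 3 + Real.log (absRamificationIdx p ((I.σ.localFieldFamily p hp.out).k v)) ≤ 4 * lmod) :
    I.HullEstimateOf
      (I.X.slotResidue I.supportPrimes +
        ((I.X.l : ℝ) + 1) / 4 * ((1 + 4 / (I.X.l : ℝ)) *
          (∑ p ∈ I.supportPrimes, if hp : p.Prime then haveI : Fact p.Prime := ⟨hp⟩
            (∑ v : placesOver F₀ p, (localDegree F₀ v.1 : ℝ) *
              differentOrd p ((I.σ.localFieldFamily p hp).k v)) / Module.finrank ℚ F₀ * Real.log p else 0)
        + 4 / (I.X.l : ℝ) * (∑ p ∈ I.supportPrimes, Real.log p)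
        + 20 / 3 * lmod * ((I.supportPrimes.filter (· ≤ N)).card : ℝ))) := by
  classical
  -- the canonical local data at every index `p` (as in c312-d1's `hullEstimateOf_ofInput_explicit`)
  let Dloc : (p : ℕ) → DstLocal (placesOver F₀ p) := fun p =>
    { lam := fun v => localDegree F₀ v.1
      lam_pos := fun v => by exact_mod_cast localDegree_pos F₀ v.1
      logDK := fun v => if hp : p.Prime then haveI : Fact p.Prime := ⟨hp⟩
        differentOrd p ((I.σ.localFieldFamily p hp).k v) * Real.log p else 0
      logDK_nonneg := fun v => by
        split_ifs with hp
        · haveI : Fact p.Prime := ⟨hp⟩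
          exact mul_nonneg (differentOrd_nonneg p _) (Real.log_natCast_nonneg p)
        · exact le_rfl
      logQ := fun v => (ofInput I).logQloc p v
      logQ_nonneg := fun v => (ofInput I).logQloc_nonneg p v
      logp := Real.log p
      logp_nonneg := Real.log_natCast_nonneg p
      iota := if p ≤ N then 1 else 0
      iota_nonneg := by split_ifs <;> norm_num }
  have hDK : ∀ (p : ℕ) [hp : Fact p.Prime], p ∈ I.supportPrimes → ∀ v : placesOver F₀ p,
      differentOrd p ((I.σ.localFieldFamily p hp.out).k v) * Real.log p ≤ (Dloc p).logDK v := by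
    intro p hp _ v
    show _ ≤ (if hp : p.Prime then _ else _)
    rw [dif_pos hp.out]
  have hR4' : ∀ (p : ℕ) [hp : Fact p.Prime], p ∈ I.supportPrimes → ∀ v : placesOver F₀ p,
      p - 2 < absRamificationIdx p ((I.σ.localFieldFamily p hp.out).k v) →
      3 + Real.log (absRamificationIdx p ((I.σ.localFieldFamily p hp.out).k v)) ≤ 4 * (Dloc p).iota * lmod := by
    intro p hp hpT v hv
    obtain ⟨hpN, hle⟩ := hR4 p hpT v hv
    show _ ≤ 4 * (if p ≤ N then (1 : ℝ) else 0) * lmod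
    rw [if_pos hpN, mul_one]
    exact hle
  have h := hullEstimateOf_ofInput_allRegime I Dloc (fun p _ v => rfl) hlmod hDK (fun p _ v => rfl)
    (fun p _ => le_rfl) hR4'
  refine hullEstimateOf_mono I h (le_of_eq ?_)
  -- identify the three sums
  have h1 : ∑ p ∈ I.supportPrimes, (Dloc p).avg (Dloc p).logDK =
      ∑ p ∈ I.supportPrimes, if hp : p.Prime then haveI : Fact p.Prime := ⟨hp⟩
        (∑ v : placesOver F₀ p, (localDegree F₀ v.1 : ℝ) *
          differentOrd p ((I.σ.localFieldFamily p hp).k v)) / Module.finrank ℚ F₀ * Real.log p else 0 := by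
    refine Finset.sum_congr rfl fun p hp => ?_
    have hp' : p.Prime := I.prime_of_mem_supportPrimes hp
    haveI : Fact p.Prime := ⟨hp'⟩
    have hDKv : ∀ v : placesOver F₀ p,
        (Dloc p).logDK v = differentOrd p ((I.σ.localFieldFamily p hp').k v) * Real.log p := by
      intro v
      show (if hp : p.Prime then _ else _) = _
      rw [dif_pos hp']
    rw [dif_pos hp', avg_eq_sum_div (Dloc p) (fun v => rfl), div_mul_eq_mul_div, Finset.sum_mul]
    congr 1
    exact Finset.sum_congr rfl fun v _ => by rw [hDKv v]; ring
  have h3 : ∑ p ∈ I.supportPrimes, (Dloc p).iota = ((I.supportPrimes.filter (· ≤ N)).card : ℝ) := by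
    show ∑ p ∈ I.supportPrimes, (if p ≤ N then (1 : ℝ) else 0) = _
    rw [Finset.sum_boole]
  rw [h1, h3]

/-- **(V) in ALL regimes — the K-level currency of the route's junction**: c312-d1's `hullEstimateOf_ofInput_stepV`
with the slot-constancy hypothesis replaced by the additive residue:
`I.HullEstimateOf (slotResidue(P_Θ; T(I)) + (l+1)/4·{(1 + 4/l)·dK + (4/l)·sQ + (20/3)·log(2^12·3^3·5·e_mod·l)·sLe})`
for any `dK, sQ, sLe` dominating the different sum, `Σ_{p∈T(I)} log p` and `#{p ∈ T(I) : p ≤ e*_mod·l}`, under the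
(R4)-shape input at `e_mod` — exactly the hypothesis `hδ` of abc-iut-S3's `Cor22.display_of_squeeze_min` plus the
residue. [cite: Mochizuki2012, IUTchIV Thm. 1.10 proof Steps (v)–(viii) p. 27–30] [claim: Mochizuki2012, status: disputed] -/
theorem hullEstimateOf_ofInput_stepV_allRegime (emod : ℕ) (hemod : 1 ≤ emod) {dK sQ sLe : ℝ}
    (hdK : (∑ p ∈ I.supportPrimes, if hp : p.Prime then haveI : Fact p.Prime := ⟨hp⟩
            (∑ v : placesOver F₀ p, (localDegree F₀ v.1 : ℝ) *
              differentOrd p ((I.σ.localFieldFamily p hp).k v)) / Module.finrank ℚ F₀ * Real.log p else 0) ≤ dK)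
    (hsQ : ∑ p ∈ I.supportPrimes, Real.log p ≤ sQ)
    (hsLe : ((I.supportPrimes.filter (· ≤ 2 ^ 12 * 3 ^ 3 * 5 * emod * I.X.l)).card : ℝ) ≤ sLe)
    (hR4 : ∀ (p : ℕ) [hp : Fact p.Prime], p ∈ I.supportPrimes → ∀ v : placesOver F₀ p,
      p - 2 < absRamificationIdx p ((I.σ.localFieldFamily p hp.out).k v) →
      p ≤ 2 ^ 12 * 3 ^ 3 * 5 * emod * I.X.l ∧
        3 + Real.log (absRamificationIdx p ((I.σ.localFieldFamily p hp.out).k v)) ≤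
          4 * Real.log ((2 : ℝ) ^ 12 * 3 ^ 3 * 5 * emod * I.X.l)) :
    I.HullEstimateOf
      (I.X.slotResidue I.supportPrimes +
        ((I.X.l : ℝ) + 1) / 4 * ((1 + 4 / (I.X.l : ℝ)) * dK + 4 / (I.X.l : ℝ) * sQ
          + 20 / 3 * Real.log ((2 : ℝ) ^ 12 * 3 ^ 3 * 5 * emod * I.X.l) * sLe)) := by
  have hl1 : 1 ≤ I.X.l := le_trans (by norm_num) I.X.five_le_l
  have hlmod := lstarMod_nonneg hemod hl1
  have h := hullEstimateOf_ofInput_explicit_allRegime I (2 ^ 12 * 3 ^ 3 * 5 * emod * I.X.l) hlmod hR4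
  refine hullEstimateOf_mono I h ?_
  have hl : (0 : ℝ) < I.X.l := by exact_mod_cast (lt_of_lt_of_le (by norm_num) hl1)
  have hc0 : (0 : ℝ) ≤ ((I.X.l : ℝ) + 1) / 4 := by positivity
  have hc1 : (0 : ℝ) ≤ 1 + 4 / (I.X.l : ℝ) := by positivity
  have hc2 : (0 : ℝ) ≤ 4 / (I.X.l : ℝ) := by positivity
  have hc3 : (0 : ℝ) ≤ 20 / 3 * Real.log ((2 : ℝ) ^ 12 * 3 ^ 3 * 5 * emod * I.X.l) := by positivity
  have e3 : 20 / 3 * Real.log ((2 : ℝ) ^ 12 * 3 ^ 3 * 5 * emod * I.X.l) *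
      ((I.supportPrimes.filter (· ≤ 2 ^ 12 * 3 ^ 3 * 5 * emod * I.X.l)).card : ℝ) ≤
      20 / 3 * Real.log ((2 : ℝ) ^ 12 * 3 ^ 3 * 5 * emod * I.X.l) * sLe := mul_le_mul_of_nonneg_left hsLe hc3
  have e1 := mul_le_mul_of_nonneg_left hdK hc1
  have e2 := mul_le_mul_of_nonneg_left hsQ hc2
  have key := mul_le_mul_of_nonneg_left (add_le_add (add_le_add e1 e2) e3) hc0
  linarith

/-- **(V) in ALL regimes with print's own values** `sQ := Σ_{p∈T(I)} log p`, `sLe := π(e*_mod·l)`: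
c312-d1's `hullEstimateOf_ofInput_stepV_pi` with `hconst` replaced by the additive residue.
[cite: Mochizuki2012, IUTchIV Thm. 1.10 proof Steps (v)–(viii) p. 27–30] [claim: Mochizuki2012, status: disputed] -/
theorem hullEstimateOf_ofInput_stepV_pi_allRegime (emod : ℕ) (hemod : 1 ≤ emod) {dK : ℝ}
    (hdK : (∑ p ∈ I.supportPrimes, if hp : p.Prime then haveI : Fact p.Prime := ⟨hp⟩
            (∑ v : placesOver F₀ p, (localDegree F₀ v.1 : ℝ) *
              differentOrd p ((I.σ.localFieldFamily p hp).k v)) / Module.finrank ℚ F₀ * Real.log p else 0) ≤ dK)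
    (hR4 : ∀ (p : ℕ) [hp : Fact p.Prime], p ∈ I.supportPrimes → ∀ v : placesOver F₀ p,
      p - 2 < absRamificationIdx p ((I.σ.localFieldFamily p hp.out).k v) →
      p ≤ 2 ^ 12 * 3 ^ 3 * 5 * emod * I.X.l ∧
        3 + Real.log (absRamificationIdx p ((I.σ.localFieldFamily p hp.out).k v)) ≤
          4 * Real.log ((2 : ℝ) ^ 12 * 3 ^ 3 * 5 * emod * I.X.l)) :
    I.HullEstimateOf
      (I.X.slotResidue I.supportPrimes +
        ((I.X.l : ℝ) + 1) / 4 * ((1 + 4 / (I.X.l : ℝ)) * dK + 4 / (I.X.l : ℝ) * (∑ p ∈ I.supportPrimes, Real.log p)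
          + 20 / 3 * Real.log ((2 : ℝ) ^ 12 * 3 ^ 3 * 5 * emod * I.X.l)
            * (Nat.primeCounting (2 ^ 12 * 3 ^ 3 * 5 * emod * I.X.l) : ℝ))) :=
  hullEstimateOf_ofInput_stepV_allRegime I emod hemod hdK le_rfl
    (card_filter_le_of_primeCounting_le I le_rfl) hR4

/-! ## In the currency of the route: `l` as a free natural number, the (R4) input in `ι`-form (all regimes) -/

/-- **(V), all regimes, with the prime written as a free natural number `L = l`** (datum-level consumers have
`I.X.l = l` by `ThetaVolumeDatumAt.l_eq`): c312-d1's `hullEstimateOf_ofInput_stepV_pi'` with `hconst` replaced by the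
additive residue. [cite: Mochizuki2012, IUTchIV Thm. 1.10 proof Steps (v)–(viii) p. 27–30] [claim: Mochizuki2012, status: disputed] -/
theorem hullEstimateOf_ofInput_stepV_pi'_allRegime {L : ℕ} (hL : I.X.l = L) (emod : ℕ) (hemod : 1 ≤ emod) {dK : ℝ}
    (hdK : (∑ p ∈ I.supportPrimes, if hp : p.Prime then haveI : Fact p.Prime := ⟨hp⟩
            (∑ v : placesOver F₀ p, (localDegree F₀ v.1 : ℝ) *
              differentOrd p ((I.σ.localFieldFamily p hp).k v)) / Module.finrank ℚ F₀ * Real.log p else 0) ≤ dK)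
    (hR4 : ∀ (p : ℕ) [hp : Fact p.Prime], p ∈ I.supportPrimes → ∀ v : placesOver F₀ p,
      p - 2 < absRamificationIdx p ((I.σ.localFieldFamily p hp.out).k v) →
      p ≤ 2 ^ 12 * 3 ^ 3 * 5 * emod * L ∧
        3 + Real.log (absRamificationIdx p ((I.σ.localFieldFamily p hp.out).k v)) ≤
          4 * Real.log ((2 : ℝ) ^ 12 * 3 ^ 3 * 5 * emod * L)) :
    I.HullEstimateOf
      (I.X.slotResidue I.supportPrimes +
        ((L : ℝ) + 1) / 4 * ((1 + 4 / (L : ℝ)) * dK + 4 / (L : ℝ) * (∑ p ∈ I.supportPrimes, Real.log p)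
          + 20 / 3 * Real.log ((2 : ℝ) ^ 12 * 3 ^ 3 * 5 * emod * L)
            * (Nat.primeCounting (2 ^ 12 * 3 ^ 3 * 5 * emod * L) : ℝ))) := by
  subst hL
  exact hullEstimateOf_ofInput_stepV_pi_allRegime I emod hemod hdK hR4

/-- **(V), all regimes, with the (R4) input in its `ι`-form** (the output shape of abc-iut-S1's
`Cor22.R4_thetaVolumeInput`), free `L = I.X.l` and free `dK, sQ, sLe`: c312-d1's
`hullEstimateOf_ofInput_stepV_of_iotaForm` with `hconst` replaced by the additive residue — so that abc-iut-S3's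
`Cor22.deltaK_le_BIII` applies to the bracket verbatim and the residue rides along.
[cite: Mochizuki2012, IUTchIV Thm. 1.10 proof Steps (iii), (v)–(viii) p. 25–30] [claim: Mochizuki2012, status: disputed] -/
theorem hullEstimateOf_ofInput_stepV_of_iotaForm_allRegime {L : ℕ} (hL : I.X.l = L) (emod : ℕ) (hemod : 1 ≤ emod)
    {dK sQ sLe : ℝ}
    (hdK : (∑ p ∈ I.supportPrimes, if hp : p.Prime then haveI : Fact p.Prime := ⟨hp⟩
            (∑ v : placesOver F₀ p, (localDegree F₀ v.1 : ℝ) *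
              differentOrd p ((I.σ.localFieldFamily p hp).k v)) / Module.finrank ℚ F₀ * Real.log p else 0) ≤ dK)
    (hsQ : ∑ p ∈ I.supportPrimes, Real.log p ≤ sQ)
    (hsLe : ((I.supportPrimes.filter (· ≤ 2 ^ 12 * 3 ^ 3 * 5 * emod * L)).card : ℝ) ≤ sLe)
    (hR4 : ∀ (p : ℕ) [hp : Fact p.Prime], p ∈ I.supportPrimes → ∀ v : placesOver F₀ p,
      p - 2 < absRamificationIdx p ((I.σ.localFieldFamily p hp.out).k v) →
      3 + Real.log (absRamificationIdx p ((I.σ.localFieldFamily p hp.out).k v)) ≤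
        4 * (if p ≤ 2 ^ 12 * 3 ^ 3 * 5 * emod * L then (1 : ℝ) else 0) *
          Real.log (((2 ^ 12 * 3 ^ 3 * 5 * emod : ℕ) : ℝ) * L)) :
    I.HullEstimateOf
      (I.X.slotResidue I.supportPrimes +
        ((L : ℝ) + 1) / 4 * ((1 + 4 / (L : ℝ)) * dK + 4 / (L : ℝ) * sQ
          + 20 / 3 * Real.log ((2 : ℝ) ^ 12 * 3 ^ 3 * 5 * emod * L) * sLe)) := by
  subst hL
  exact hullEstimateOf_ofInput_stepV_allRegime I emod hemod hdK hsQ hsLe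
    (fun p hp hpT v hv => r4_of_iotaForm (hR4 p hpT v) hv)

/-- **`sLe := π(e*_mod·l)` is admissible** in the previous theorem (c312-d1's `card_filter_le_primeCounting`); then
abc-iut-S3's `hsLele` is `le_rfl`. All regimes. [cite: Mochizuki2012, IUTchIV Thm. 1.10 proof Step (viii) p. 30] -/
theorem hullEstimateOf_ofInput_stepV_of_iotaForm_pi_allRegime {L : ℕ} (hL : I.X.l = L) (emod : ℕ)
    (hemod : 1 ≤ emod) {dK sQ : ℝ}
    (hdK : (∑ p ∈ I.supportPrimes, if hp : p.Prime then haveI : Fact p.Prime := ⟨hp⟩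
            (∑ v : placesOver F₀ p, (localDegree F₀ v.1 : ℝ) *
              differentOrd p ((I.σ.localFieldFamily p hp).k v)) / Module.finrank ℚ F₀ * Real.log p else 0) ≤ dK)
    (hsQ : ∑ p ∈ I.supportPrimes, Real.log p ≤ sQ)
    (hR4 : ∀ (p : ℕ) [hp : Fact p.Prime], p ∈ I.supportPrimes → ∀ v : placesOver F₀ p,
      p - 2 < absRamificationIdx p ((I.σ.localFieldFamily p hp.out).k v) →
      3 + Real.log (absRamificationIdx p ((I.σ.localFieldFamily p hp.out).k v)) ≤
        4 * (if p ≤ 2 ^ 12 * 3 ^ 3 * 5 * emod * L then (1 : ℝ) else 0) *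
          Real.log (((2 ^ 12 * 3 ^ 3 * 5 * emod : ℕ) : ℝ) * L)) :
    I.HullEstimateOf
      (I.X.slotResidue I.supportPrimes +
        ((L : ℝ) + 1) / 4 * ((1 + 4 / (L : ℝ)) * dK + 4 / (L : ℝ) * sQ
          + 20 / 3 * Real.log ((2 : ℝ) ^ 12 * 3 ^ 3 * 5 * emod * L)
            * (Nat.primeCounting (2 ^ 12 * 3 ^ 3 * 5 * emod * L) : ℝ))) :=
  hullEstimateOf_ofInput_stepV_of_iotaForm_allRegime I hL emod hemod hdK hsQ
    (card_filter_le_of_primeCounting_le I le_rfl) hR4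

end Input

end DHData

end Summit.ABC.IUTFork

end
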